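import Literature.Algebra.Polynomial.CasasAlvero.Pentanomial
import HarnessLib

/-!
# The five-witness criterion (centred hexanomials) and the digit `8` in characteristics `79` and `89`

Sequel to `Trinomial.lean`, `Char23Digits.lean` (tetranomials) and `Pentanomial.lean`: a centred hexanomial
`X^d + s X^m + t X^n + u X^l + v X^j + w X^g` (`0 < g < j < l < n < m < d`, `w ≠ 0`) over a field `K` with `K`-rational roots
`ρ, σ, τ, υ, φ` killing the Hasse derivatives `H_m, H_n, H_l, H_j, H_g` respectively is a Casas-Alvero polynomial (every other index
`0 < i < d` is vacuous at the root `0`) and is not a `d`-th power, so `¬ CA_d(K)`; in prime characteristic the ten conditions are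
integer congruences.

Needed for the digit `8` in characteristic `79`: the exhaustive coefficient-first sparse search (kit job j072075, seat-2 g5 packet) and
the witness-first linear search over all supports with `≤ 4` inner monomials (`ws/wsearch.py`, 7.1·10⁶ linear systems) found NO centred
polynomial of degree `8` over `𝔽_79` with `≤ 4` inner terms and `𝔽_79`-rational witnesses, while the `5`-inner-term search (kit job
j074355, `ws/wsjob.py`, JOB_TASKS=79:8:5) finds `X^8 - 28X^6 - 33X^5 + 27X^4 + 13X^3 + 20X`.  For characteristic `89` the same job
(JOB_TASKS=89:8:4) finds the pentanomial `X^8 - 28X^6 - 8X^5 + 34X^4 + X^2`, an instance of `Pentanomial.lean`'s four-witness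
criterion.  Hence `79` and `89` are BAD primes for degree `8` — in accordance with [CastryckLaterveerOunaies2012, Thm. 4 and §4]
(every prime below the degree-`8` bound is expected bad; CLO report no good prime for `d = 8` at all in their range) — which was the
last digit missing for the complete classification of the Casas-Alvero degrees in characteristics `79` and `89`
(`CharSeventyNineComplete.lean`, `CharEightyNineComplete.lean`).  Every example was re-checked by the independent brute-force
checker `cls/check2.py` (all Hasse derivatives, all roots in `𝔽_p`) before the Lean kernel check below. [folklore]
-/

noncomputable section

open Polynomial

namespace Literature.Algebra.Polynomial.CasasAlvero

section Hexanomial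

variable {K : Type*} [Field K] {d m n l j g : ℕ}

/-- the tail of the centred hexanomial has degree `< d`. [folklore] -/
private theorem natDegree_hexanom_tail_lt (hgj : g < j) (hjl : j < l) (hln : l < n) (hnm : n < m) (hmd : m < d) (s t u v w : K) :
    (s • (X : K[X]) ^ m + t • X ^ n + u • X ^ l + v • X ^ j + w • X ^ g).natDegree < d := by
  refine lt_of_le_of_lt (natDegree_add_le _ _) (max_lt (natDegree_pentanom_tail_lt hjl hln hnm hmd s t u v) ?_)
  exact lt_of_le_of_lt (le_trans (natDegree_smul_le _ _) (natDegree_X_pow_le g)) (by omega)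

/-- reassociation of the hexanomial as `X^d + tail`. [folklore] -/
private theorem hexanom_eq (s t u v w : K) :
    (X ^ d + s • X ^ m + t • X ^ n + u • X ^ l + v • X ^ j + w • X ^ g : K[X]) =
      X ^ d + (s • X ^ m + t • X ^ n + u • X ^ l + v • X ^ j + w • X ^ g) := by
  simp only [add_assoc]

/-- its degree is `d`. [folklore] -/
private theorem natDegree_hexanom (hgj : g < j) (hjl : j < l) (hln : l < n) (hnm : n < m) (hmd : m < d) (s t u v w : K) :
    (X ^ d + s • X ^ m + t • X ^ n + u • X ^ l + v • X ^ j + w • X ^ g : K[X]).natDegree = d := by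
  rw [hexanom_eq, natDegree_add_eq_left_of_natDegree_lt]
  · exact natDegree_X_pow d
  · rw [natDegree_X_pow]; exact natDegree_hexanom_tail_lt hgj hjl hln hnm hmd s t u v w

/-- it is monic. [folklore] -/
private theorem monic_hexanom (hgj : g < j) (hjl : j < l) (hln : l < n) (hnm : n < m) (hmd : m < d) (s t u v w : K) :
    (X ^ d + s • X ^ m + t • X ^ n + u • X ^ l + v • X ^ j + w • X ^ g : K[X]).Monic := by
  have h := natDegree_hexanom_tail_lt hgj hjl hln hnm hmd s t u v w
  rw [hexanom_eq]
  exact (monic_X_pow d).add_of_left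
    (lt_of_le_of_lt degree_le_natDegree (by rw [degree_X_pow]; exact_mod_cast h))

/-- coefficients of the hexanomial. [folklore] -/
private theorem coeff_hexanom (s t u v w : K) (i : ℕ) :
    (X ^ d + s • X ^ m + t • X ^ n + u • X ^ l + v • X ^ j + w • X ^ g : K[X]).coeff i =
      (if i = d then 1 else 0) + (if i = m then s else 0) + (if i = n then t else 0) + (if i = l then u else 0) +
        (if i = j then v else 0) + (if i = g then w else 0) := by
  simp only [coeff_add, coeff_smul, coeff_X_pow, smul_eq_mul, mul_ite, mul_one, mul_zero]

/-- evaluation of the hexanomial. [folklore] -/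
private theorem eval_hexanom (s t u v w x : K) :
    (X ^ d + s • X ^ m + t • X ^ n + u • X ^ l + v • X ^ j + w • X ^ g : K[X]).eval x =
      x ^ d + s * x ^ m + t * x ^ n + u * x ^ l + v * x ^ j + w * x ^ g := by
  simp only [eval_add, eval_smul, eval_pow, eval_X, smul_eq_mul]

/-- evaluation of its `m`-th Hasse derivative. [folklore] -/
private theorem eval_hasseDeriv_hexanom_m (hgj : g < j) (hjl : j < l) (hln : l < n) (hnm : n < m) (s t u v w x : K) :
    (hasseDeriv m (X ^ d + s • X ^ m + t • X ^ n + u • X ^ l + v • X ^ j + w • X ^ g : K[X])).eval x =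
      (d.choose m : K) * x ^ (d - m) + s := by
  simp only [map_add, map_smul, hasseDeriv_X_pow, eval_add, eval_smul, eval_mul, eval_C, eval_pow, eval_X, smul_eq_mul,
    Nat.choose_self, Nat.sub_self, pow_zero, mul_one, Nat.cast_one, Nat.choose_eq_zero_of_lt hnm,
    Nat.choose_eq_zero_of_lt (lt_trans hln hnm), Nat.choose_eq_zero_of_lt (lt_trans (lt_trans hjl hln) hnm),
    Nat.choose_eq_zero_of_lt (lt_trans (lt_trans (lt_trans hgj hjl) hln) hnm), Nat.cast_zero,
    zero_mul, mul_zero, add_zero]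

/-- evaluation of its `n`-th Hasse derivative. [folklore] -/
private theorem eval_hasseDeriv_hexanom_n (hgj : g < j) (hjl : j < l) (hln : l < n) (s t u v w x : K) :
    (hasseDeriv n (X ^ d + s • X ^ m + t • X ^ n + u • X ^ l + v • X ^ j + w • X ^ g : K[X])).eval x =
      (d.choose n : K) * x ^ (d - n) + (m.choose n : K) * s * x ^ (m - n) + t := by
  simp only [map_add, map_smul, hasseDeriv_X_pow, eval_add, eval_smul, eval_mul, eval_C, eval_pow, eval_X, smul_eq_mul,
    Nat.choose_self, Nat.sub_self, pow_zero, mul_one, Nat.cast_one, Nat.choose_eq_zero_of_lt hln,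
    Nat.choose_eq_zero_of_lt (lt_trans hjl hln), Nat.choose_eq_zero_of_lt (lt_trans (lt_trans hgj hjl) hln), Nat.cast_zero,
    zero_mul, mul_zero, add_zero]
  ring

/-- evaluation of its `l`-th Hasse derivative. [folklore] -/
private theorem eval_hasseDeriv_hexanom_l (hgj : g < j) (hjl : j < l) (s t u v w x : K) :
    (hasseDeriv l (X ^ d + s • X ^ m + t • X ^ n + u • X ^ l + v • X ^ j + w • X ^ g : K[X])).eval x =
      (d.choose l : K) * x ^ (d - l) + (m.choose l : K) * s * x ^ (m - l) + (n.choose l : K) * t * x ^ (n - l) + u := by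
  simp only [map_add, map_smul, hasseDeriv_X_pow, eval_add, eval_smul, eval_mul, eval_C, eval_pow, eval_X, smul_eq_mul,
    Nat.choose_self, Nat.sub_self, pow_zero, mul_one, Nat.cast_one, Nat.choose_eq_zero_of_lt hjl,
    Nat.choose_eq_zero_of_lt (lt_trans hgj hjl), Nat.cast_zero, zero_mul, mul_zero, add_zero]
  ring

/-- evaluation of its `j`-th Hasse derivative. [folklore] -/
private theorem eval_hasseDeriv_hexanom_j (hgj : g < j) (s t u v w x : K) :
    (hasseDeriv j (X ^ d + s • X ^ m + t • X ^ n + u • X ^ l + v • X ^ j + w • X ^ g : K[X])).eval x =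
      (d.choose j : K) * x ^ (d - j) + (m.choose j : K) * s * x ^ (m - j) + (n.choose j : K) * t * x ^ (n - j) +
        (l.choose j : K) * u * x ^ (l - j) + v := by
  simp only [map_add, map_smul, hasseDeriv_X_pow, eval_add, eval_smul, eval_mul, eval_C, eval_pow, eval_X, smul_eq_mul,
    Nat.choose_self, Nat.sub_self, pow_zero, mul_one, Nat.cast_one, Nat.choose_eq_zero_of_lt hgj, Nat.cast_zero, zero_mul,
    mul_zero, add_zero]
  ring

/-- evaluation of its `g`-th Hasse derivative. [folklore] -/
private theorem eval_hasseDeriv_hexanom_g (s t u v w x : K) :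
    (hasseDeriv g (X ^ d + s • X ^ m + t • X ^ n + u • X ^ l + v • X ^ j + w • X ^ g : K[X])).eval x =
      (d.choose g : K) * x ^ (d - g) + (m.choose g : K) * s * x ^ (m - g) + (n.choose g : K) * t * x ^ (n - g) +
        (l.choose g : K) * u * x ^ (l - g) + (j.choose g : K) * v * x ^ (j - g) + w := by
  simp only [map_add, map_smul, hasseDeriv_X_pow, eval_add, eval_smul, eval_mul, eval_C, eval_pow, eval_X, smul_eq_mul,
    Nat.choose_self, Nat.sub_self, pow_zero, mul_one, Nat.cast_one]
  ring

/-- **five-witness criterion**: a centred hexanomial with roots killing `H_m`, `H_n`, `H_l`, `H_j`, `H_g` is Casas-Alvero — the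
mechanism of the positive-characteristic counter-examples of [GvBLSW 2007, §3] (there `X^{p+1} - X^p`, Prop. 7), for sparse centred
polynomials with rational witnesses. [cite: GrafVonBothmerEtAl2007, §3 (Prop. 7)] -/
theorem isCasasAlvero_hexanom (hg0 : 0 < g) (hgj : g < j) (hjl : j < l) (hln : l < n) (hnm : n < m) (hmd : m < d)
    {s t u v w ρ σ τ υ φ : K}
    (hρf : (X ^ d + s • X ^ m + t • X ^ n + u • X ^ l + v • X ^ j + w • X ^ g : K[X]).eval ρ = 0)
    (hρH : (hasseDeriv m (X ^ d + s • X ^ m + t • X ^ n + u • X ^ l + v • X ^ j + w • X ^ g : K[X])).eval ρ = 0)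
    (hσf : (X ^ d + s • X ^ m + t • X ^ n + u • X ^ l + v • X ^ j + w • X ^ g : K[X]).eval σ = 0)
    (hσH : (hasseDeriv n (X ^ d + s • X ^ m + t • X ^ n + u • X ^ l + v • X ^ j + w • X ^ g : K[X])).eval σ = 0)
    (hτf : (X ^ d + s • X ^ m + t • X ^ n + u • X ^ l + v • X ^ j + w • X ^ g : K[X]).eval τ = 0)
    (hτH : (hasseDeriv l (X ^ d + s • X ^ m + t • X ^ n + u • X ^ l + v • X ^ j + w • X ^ g : K[X])).eval τ = 0)
    (hυf : (X ^ d + s • X ^ m + t • X ^ n + u • X ^ l + v • X ^ j + w • X ^ g : K[X]).eval υ = 0)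
    (hυH : (hasseDeriv j (X ^ d + s • X ^ m + t • X ^ n + u • X ^ l + v • X ^ j + w • X ^ g : K[X])).eval υ = 0)
    (hφf : (X ^ d + s • X ^ m + t • X ^ n + u • X ^ l + v • X ^ j + w • X ^ g : K[X]).eval φ = 0)
    (hφH : (hasseDeriv g (X ^ d + s • X ^ m + t • X ^ n + u • X ^ l + v • X ^ j + w • X ^ g : K[X])).eval φ = 0) :
    IsCasasAlvero (X ^ d + s • X ^ m + t • X ^ n + u • X ^ l + v • X ^ j + w • X ^ g : K[X]) := by
  intro i hi0 hi
  rw [natDegree_hexanom hgj hjl hln hnm hmd] at hi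
  by_cases him : i = m
  · subst him; exact ⟨ρ, hρf, hρH⟩
  by_cases hin : i = n
  · subst hin; exact ⟨σ, hσf, hσH⟩
  by_cases hil : i = l
  · subst hil; exact ⟨τ, hτf, hτH⟩
  by_cases hij : i = j
  · subst hij; exact ⟨υ, hυf, hυH⟩
  by_cases hig : i = g
  · subst hig; exact ⟨φ, hφf, hφH⟩
  apply sharesRoot_of_coeff_eq_zero
  · rw [eval_hexanom, zero_pow (by omega), zero_pow (by omega), zero_pow (by omega), zero_pow (by omega),
      zero_pow (by omega), zero_pow (by omega)]; ring
  · rw [coeff_hexanom, if_neg (by omega), if_neg him, if_neg hin, if_neg hil, if_neg hij, if_neg hig]; ring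

/-- a centred hexanomial with `w ≠ 0` is not a pure `d`-th power. [cite: GrafVonBothmerEtAl2007, §3 (Prop. 7)] -/
theorem hexanom_ne_pow (hg0 : 0 < g) (hgj : g < j) (hjl : j < l) (hln : l < n) (hnm : n < m) (hmd : m < d)
    {s t u v w : K} (hw : w ≠ 0) (a : K) :
    (X ^ d + s • X ^ m + t • X ^ n + u • X ^ l + v • X ^ j + w • X ^ g : K[X]) ≠ (X - C a) ^ d := by
  intro h
  have h0 := congrArg (eval 0) h
  rw [eval_hexanom, zero_pow (by omega), zero_pow (by omega), zero_pow (by omega), zero_pow (by omega),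
    zero_pow (by omega), zero_pow (by omega)] at h0
  simp only [mul_zero, add_zero, eval_pow, eval_sub, eval_X, eval_C, zero_sub] at h0
  have ha : a = 0 := neg_eq_zero.mp ((pow_eq_zero_iff (by omega : d ≠ 0)).mp h0.symm)
  subst ha
  have hc := congrArg (fun q : K[X] => q.coeff g) h
  simp only [coeff_hexanom, map_zero, sub_zero, coeff_X_pow, if_neg (by omega : ¬ g = d),
    if_neg (by omega : ¬ g = m), if_neg (by omega : ¬ g = n), if_neg (by omega : ¬ g = l), if_neg (ne_of_lt hgj),
    zero_add] at hc
  exact hw hc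

/-- **hexanomial refutation of `CA_d`**: ten identities in `K` and `w ≠ 0` give a Casas-Alvero polynomial of degree `d`
that is not a `d`-th power (a counter-example in the sense of [GvBLSW 2007, §3]). [cite: GrafVonBothmerEtAl2007, §3 (Prop. 7)] -/
theorem not_holdsInDegree_of_hexanomial (hg0 : 0 < g) (hgj : g < j) (hjl : j < l) (hln : l < n) (hnm : n < m)
    (hmd : m < d) {s t u v w : K} (hw : w ≠ 0) (ρ σ τ υ φ : K)
    (h1 : ρ ^ d + s * ρ ^ m + t * ρ ^ n + u * ρ ^ l + v * ρ ^ j + w * ρ ^ g = 0)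
    (h2 : (d.choose m : K) * ρ ^ (d - m) + s = 0)
    (h3 : σ ^ d + s * σ ^ m + t * σ ^ n + u * σ ^ l + v * σ ^ j + w * σ ^ g = 0)
    (h4 : (d.choose n : K) * σ ^ (d - n) + (m.choose n : K) * s * σ ^ (m - n) + t = 0)
    (h5 : τ ^ d + s * τ ^ m + t * τ ^ n + u * τ ^ l + v * τ ^ j + w * τ ^ g = 0)
    (h6 : (d.choose l : K) * τ ^ (d - l) + (m.choose l : K) * s * τ ^ (m - l) + (n.choose l : K) * t * τ ^ (n - l) + u = 0)
    (h7 : υ ^ d + s * υ ^ m + t * υ ^ n + u * υ ^ l + v * υ ^ j + w * υ ^ g = 0)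
    (h8 : (d.choose j : K) * υ ^ (d - j) + (m.choose j : K) * s * υ ^ (m - j) + (n.choose j : K) * t * υ ^ (n - j) +
      (l.choose j : K) * u * υ ^ (l - j) + v = 0)
    (h9 : φ ^ d + s * φ ^ m + t * φ ^ n + u * φ ^ l + v * φ ^ j + w * φ ^ g = 0)
    (h10 : (d.choose g : K) * φ ^ (d - g) + (m.choose g : K) * s * φ ^ (m - g) + (n.choose g : K) * t * φ ^ (n - g) +
      (l.choose g : K) * u * φ ^ (l - g) + (j.choose g : K) * v * φ ^ (j - g) + w = 0) :
    ¬ HoldsInDegree K d := by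
  intro h
  have hCA : IsCasasAlvero (X ^ d + s • X ^ m + t • X ^ n + u • X ^ l + v • X ^ j + w • X ^ g : K[X]) :=
    isCasasAlvero_hexanom hg0 hgj hjl hln hnm hmd (by rw [eval_hexanom]; exact h1)
      (by rw [eval_hasseDeriv_hexanom_m hgj hjl hln hnm]; exact h2) (by rw [eval_hexanom]; exact h3)
      (by rw [eval_hasseDeriv_hexanom_n hgj hjl hln]; exact h4) (by rw [eval_hexanom]; exact h5)
      (by rw [eval_hasseDeriv_hexanom_l hgj hjl]; exact h6) (by rw [eval_hexanom]; exact h7)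
      (by rw [eval_hasseDeriv_hexanom_j hgj]; exact h8) (by rw [eval_hexanom]; exact h9)
      (by rw [eval_hasseDeriv_hexanom_g]; exact h10)
  obtain ⟨a, ha⟩ := h _ (monic_hexanom hgj hjl hln hnm hmd s t u v w) (natDegree_hexanom hgj hjl hln hnm hmd s t u v w) hCA
  exact hexanom_ne_pow hg0 hgj hjl hln hnm hmd hw a ha

end Hexanomial

/-! ### The instances: `79` and `89` are bad primes for degree `8` -/

section Digit8

variable (K : Type*) [Field K]

/-- `X^8 - 28X^6 - 33X^5 + 27X^4 + 13X^3 + 20X` refutes `CA_8` in characteristic `79` (`H_6`-witness `1`, `H_5`-witness `78`,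
`H_4`-witness `78`, `H_3`-witness `78`, `H_1`-witness `1`); an explicit bad-digit witness in the sense of the bad-prime
computations of [cite: CastryckLaterveerOunaies2012, Thm. 4]. Found by the witness-first linear search (kit job j074355) — no example with `≤ 4` inner terms exists. -/
theorem not_holdsInDegree_eight_of_char_79 [CharP K 79] : ¬ HoldsInDegree K 8 := by
  have hp : (79 : K) = 0 := by simpa using CharP.cast_eq_zero K 79
  refine not_holdsInDegree_of_hexanomial (d := 8) (m := 6) (n := 5) (l := 4) (j := 3) (g := 1) (by norm_num)
    (by norm_num) (by norm_num) (by norm_num) (by norm_num) (by norm_num) (s := -28) (t := -33) (u := 27) (v := 13) (w := 20)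
    ?_ 1 78 78 78 1 ?_ ?_ ?_ ?_ ?_ ?_ ?_ ?_ ?_ ?_
  · intro h
    have h' : ((20 : ℕ) : K) = 0 := by exact_mod_cast h
    rw [CharP.cast_eq_zero_iff K 79] at h'
    norm_num at h'
  · linear_combination (0 : K) * hp
  · simp only [show Nat.choose 8 6 = 28 from rfl]
    push_cast
    linear_combination (0 : K) * hp
  · linear_combination (17262208996032 : K) * hp
  · simp only [show Nat.choose 8 5 = 56 from rfl, show Nat.choose 6 5 = 6 from rfl]
    push_cast
    linear_combination (336225 : K) * hp
  · linear_combination (17262208996032 : K) * hp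
  · simp only [show Nat.choose 8 4 = 70 from rfl, show Nat.choose 6 4 = 15 from rfl, show Nat.choose 5 4 = 5 from rfl]
    push_cast
    linear_combination (32765643 : K) * hp
  · linear_combination (17262208996032 : K) * hp
  · simp only [show Nat.choose 8 3 = 56 from rfl, show Nat.choose 6 3 = 20 from rfl, show Nat.choose 5 3 = 10 from rfl, show Nat.choose 4 3 = 4 from rfl]
    push_cast
    linear_combination (2043215395 : K) * hp
  · linear_combination (0 : K) * hp
  · simp only [show Nat.choose 8 1 = 8 from rfl, show Nat.choose 6 1 = 6 from rfl, show Nat.choose 5 1 = 5 from rfl, show Nat.choose 4 1 = 4 from rfl, show Nat.choose 3 1 = 3 from rfl]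
    push_cast
    linear_combination (-2 : K) * hp

/-- `X^8 - 28X^6 - 8X^5 + 34X^4 + X^2` refutes `CA_8` in characteristic `89` (`H_6`-witness `1`, `H_5`-witness `70`,
`H_4`-witness `1`, `H_2`-witness `1`); an explicit bad-digit witness in the sense of the bad-prime
computations of [cite: CastryckLaterveerOunaies2012, Thm. 4]. -/
theorem not_holdsInDegree_eight_of_char_89 [CharP K 89] : ¬ HoldsInDegree K 8 := by
  have hp : (89 : K) = 0 := by simpa using CharP.cast_eq_zero K 89
  refine not_holdsInDegree_of_pentanomial (d := 8) (m := 6) (n := 5) (l := 4) (j := 2) (by norm_num) (by norm_num)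
    (by norm_num) (by norm_num) (by norm_num) (s := -28) (t := -8) (u := 34) (v := 1) ?_ 1 70 1 1
    ?_ ?_ ?_ ?_ ?_ ?_ ?_ ?_
  · intro h
    have h' : ((1 : ℕ) : K) = 0 := by exact_mod_cast h
    rw [CharP.cast_eq_zero_iff K 89] at h'
    norm_num at h'
  · linear_combination (0 : K) * hp
  · simp only [show Nat.choose 8 6 = 28 from rfl]
    push_cast
    linear_combination (0 : K) * hp
  · linear_combination (6440149424100 : K) * hp
  · simp only [show Nat.choose 8 5 = 56 from rfl, show Nat.choose 6 5 = 6 from rfl]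
    push_cast
    linear_combination (215688 : K) * hp
  · linear_combination (0 : K) * hp
  · simp only [show Nat.choose 8 4 = 70 from rfl, show Nat.choose 6 4 = 15 from rfl, show Nat.choose 5 4 = 5 from rfl]
    push_cast
    linear_combination (-4 : K) * hp
  · linear_combination (0 : K) * hp
  · simp only [show Nat.choose 8 2 = 28 from rfl, show Nat.choose 6 2 = 15 from rfl, show Nat.choose 5 2 = 10 from rfl, show Nat.choose 4 2 = 6 from rfl]
    push_cast
    linear_combination (-3 : K) * hp

end Digit8

end Literature.Algebra.Polynomial.CasasAlvero
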